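import Summits.PneNP.PneNP.Theorems.ConvexRankGatesCaptureDualSDPLemmas
import HarnessLib

/-!
# Crux `Capture` (stmt-PneNP-2659) — duality audit, cell D7: the CONV class (SDP slice included) is
# CLOSED under Boolean duality — the dual of a CONV gate is ONE CONV gate

A CONV gate accepts `v` iff `{Y ⪰ 0 : tr(Aᵢ Y) ≤ bᵢ + (B[v])ᵢ ∀ i}` is feasible (`B ≥ 0`, `p` rows, a `q × q`
matrix variable, arity `n`). Its Boolean DUAL `f^d(v) = ¬ f(¬ v)` accepts `v` iff the system at the
complementary input `c(v) = b + B[¬ v]` is INFEASIBLE. Three finite-input observations turn this into ONE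
CONV gate again (`dualSDP_isConvGate`, width `2q² + q + p + 2n + 2`):

* TRACE BOUND. Choosing one feasible witness per rejected input and `T` ≥ all their traces, feasibility of
  the system at `c(v)` is equivalent to feasibility of the trace-bounded system (`tr Y ≤ T`) for EVERY input.
* EXACT CERTIFICATES. For trace-bounded systems infeasibility is equivalent to a certificate `z ≥ 0`,
  `λ ≥ 0`, `P = ½ Σᵢ zᵢ (Aᵢ + Aᵢᵀ) + λ I ⪰ 0`, `Σᵢ zᵢ cᵢ + λ T ≤ −1` (`sdp_infeasible_iff_cert`,
  `ConvexRankGatesCaptureDualSDPLemmas.lean`: the trace bound closes the image cone, then Hahn–Banach) — no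
  Slater condition, no Ramana-type extended dual is needed.
* BIG-`M`. The only place the input enters is `Σᵢ zᵢ cᵢ(v) = zᵀb + Σ_k (1 − [v_k]) (Bᵀz)_k`, linearised as
  in the LP cell (`dualLP_isConvGate`): slacks `μ_k ≥ 0`, rows `(Bᵀz)_k − μ_k ≤ M [v_k]`,
  `zᵀb + Σ_k μ_k + λ T ≤ −1`, `M` bounding one chosen certificate per accepted input.

The matrix variable of the dual gate is `[[P, *], [*, diag(z, μ, λ)]] ⪰ 0` (off-diagonal junk is harmless:
principal blocks of a PSD matrix are PSD), with `2q²` rows tying `P` to `(z, λ)`. Hence the CONV row of the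
duality audit (`Cruxes/Capture/DUALITY-AUDIT-c7.md`) is closed EXACTLY, not only on its LP slice; a corollary
in the crux's own vocabulary is `isConvGate_bdual`. [folklore]
-/

namespace Summit.PneNP.PneNP.Theorems.Capture.DualityAudit

set_option linter.dupNamespace false -- `Summit.PneNP.PneNP.…`: summit = sub-problem (D-0017)

open Literature.Computability.Complexity Finset Matrix

noncomputable section

/-- Entries of the certificate matrix `½ Σ_r z_r (A_r + A_rᵀ) + λ I`. [folklore] -/
theorem certMat_apply {R Q : Type} [Fintype R] [DecidableEq Q] (A : R → Matrix Q Q ℝ) (z : R → ℝ)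
    (lam : ℝ) (u u' : Q) :
    ((2 : ℝ)⁻¹ • ∑ r, z r • (A r + (A r)ᵀ) + lam • (1 : Matrix Q Q ℝ)) u u' =
      (2 : ℝ)⁻¹ * ∑ r, z r * (A r u u' + A r u' u) + lam * (if u = u' then 1 else 0) := by
  simp only [Matrix.add_apply, Matrix.smul_apply, Matrix.sum_apply, transpose_apply, Matrix.one_apply,
    smul_eq_mul]

/-- A block matrix `[[P, 0], [0, D]]` with `P ⪰ 0` and `D` a non-negative diagonal is `⪰ 0`. [folklore] -/
theorem posSemidef_fromBlocks_diagonal {Q S : Type} [Fintype Q] [Fintype S] [DecidableEq S]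
    {P : Matrix Q Q ℝ} (hP : P.PosSemidef) {d : S → ℝ} (hd : ∀ a, 0 ≤ d a) :
    (Matrix.fromBlocks P 0 0 (Matrix.diagonal d)).PosSemidef := by
  have hD : (Matrix.diagonal d).PosSemidef := PosSemidef.diagonal fun a => hd a
  refine PosSemidef.of_dotProduct_mulVec_nonneg (Matrix.IsHermitian.fromBlocks hP.1 (by simp) hD.1)
    fun x => ?_
  have hx : x = Sum.elim (x ∘ Sum.inl) (x ∘ Sum.inr) := (Sum.elim_comp_inl_inr x).symm
  rw [star_trivial, hx, Matrix.fromBlocks_mulVec, sumElim_dotProduct_sumElim]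
  simp only [Matrix.zero_mulVec, add_zero, zero_add]
  have h1 := hP.dotProduct_mulVec_nonneg (x ∘ Sum.inl)
  have h2 := hD.dotProduct_mulVec_nonneg (x ∘ Sum.inr)
  rw [star_trivial] at h1 h2
  exact add_nonneg h1 h2

/-- **Duality-audit cell D7 (registered sub-goal `dualSDP_isConvGate`)**: the Boolean DUAL of a CONV gate —
`f v = 1 ↔ {Y ⪰ 0 : tr(Aᵢ Y) ≤ bᵢ + (B[¬ v])ᵢ ∀ i}` is INFEASIBLE (`B ≥ 0`, `p` rows, `q × q` variable,
arity `n`) — is ONE CONV gate of width `2q² + q + p + 2n + 2`: the SDP in the certificate variables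
`[[P, *], [*, diag(z, μ, λ)]] ⪰ 0` with rows `P = ½ Σᵢ zᵢ (Aᵢ + Aᵢᵀ) + λ I` (as `2q²` inequalities),
`(Bᵀ z)_k − μ_k ≤ M [v_k]`, `zᵀ b + Σ_k μ_k + T λ ≤ −1`, where `T` bounds the trace of one chosen feasible
witness per rejected input and `M` bounds one chosen exact certificate per accepted input. [folklore] -/
theorem dualSDP_isConvGate : ∀ (n p q : ℕ) (A : Fin p → Matrix (Fin q) (Fin q) ℝ) (b : Fin p → ℝ)
    (B : Fin p → Fin n → ℝ), (∀ i k, 0 ≤ B i k) → ∀ f : (Fin n → Bool) → Bool,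
    (∀ v, f v = true ↔ ¬ ∃ Y : Matrix (Fin q) (Fin q) ℝ, Y.PosSemidef ∧
      ∀ i, (A i * Y).trace ≤ b i + ∑ k, B i k * (if v k then (0 : ℝ) else 1)) →
    IsConvGate (2 * (q * q) + q + p + 2 * n + 2) ⟨n, f⟩ := by
  intro n p q A b B hB f hf
  classical
  -- the complementary right-hand side
  let c : (Fin n → Bool) → Fin p → ℝ := fun v i => b i + ∑ k, B i k * (if v k then (0 : ℝ) else 1)
  -- one feasible witness per rejected input, and the trace bound `T`
  have hfeas : ∀ v, f v = false → ∃ Y : Matrix (Fin q) (Fin q) ℝ, Y.PosSemidef ∧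
      ∀ i, (A i * Y).trace ≤ c v i := by
    intro v hv
    by_contra h
    have h' := (hf v).2 h
    rw [hv] at h'
    exact Bool.false_ne_true h'
  let Yc : (Fin n → Bool) → Matrix (Fin q) (Fin q) ℝ := fun v =>
    if hv : f v = false then Classical.choose (hfeas v hv) else 0
  have hYc : ∀ v, f v = false → (Yc v).PosSemidef ∧ ∀ i, (A i * Yc v).trace ≤ c v i := fun v hv => by
    simp only [Yc, dif_pos hv]
    exact Classical.choose_spec (hfeas v hv)
  have hYc0 : ∀ v, (Yc v).PosSemidef := fun v => by
    by_cases hv : f v = false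
    · exact (hYc v hv).1
    · simp only [Yc, dif_neg hv]
      exact PosSemidef.zero
  let T : ℝ := ∑ v, (Yc v).trace
  have hT : ∀ v, (Yc v).trace ≤ T := fun v =>
    Finset.single_le_sum (f := fun v => (Yc v).trace) (fun v _ => (hYc0 v).trace_nonneg) (Finset.mem_univ v)
  -- `f v = 1` iff the TRACE-BOUNDED complementary system is infeasible
  have hkey : ∀ v, f v = true ↔ ¬ ∃ Y : Matrix (Fin q) (Fin q) ℝ, Y.PosSemidef ∧
      (∀ i, (A i * Y).trace ≤ c v i) ∧ Y.trace ≤ T := by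
    intro v
    constructor
    · rintro hv ⟨Y, hY, hcY, -⟩
      exact (hf v).1 hv ⟨Y, hY, hcY⟩
    · intro h
      by_contra hv
      have hv' : f v = false := by simpa using hv
      exact h ⟨Yc v, (hYc v hv').1, (hYc v hv').2, hT v⟩
  -- one exact certificate per accepted input, and the common bound `M`
  have hcert : ∀ v, f v = true → ∃ zl : (Fin p → ℝ) × ℝ, (∀ i, 0 ≤ zl.1 i) ∧ 0 ≤ zl.2 ∧
      ((2 : ℝ)⁻¹ • ∑ i, zl.1 i • (A i + (A i)ᵀ) + zl.2 • (1 : Matrix (Fin q) (Fin q) ℝ)).PosSemidef ∧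
      ∑ i, zl.1 i * c v i + zl.2 * T ≤ -1 := fun v hv => by
    obtain ⟨z, lam, h⟩ := (sdp_infeasible_iff_cert A (c v) T).1 ((hkey v).1 hv)
    exact ⟨(z, lam), h⟩
  let zl : (Fin n → Bool) → (Fin p → ℝ) × ℝ := fun v =>
    if hv : f v = true then Classical.choose (hcert v hv) else (0, 0)
  have hzl : ∀ v, f v = true → (∀ i, 0 ≤ (zl v).1 i) ∧ 0 ≤ (zl v).2 ∧
      ((2 : ℝ)⁻¹ • ∑ i, (zl v).1 i • (A i + (A i)ᵀ) + (zl v).2 • (1 : Matrix (Fin q) (Fin q) ℝ)).PosSemidef ∧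
      ∑ i, (zl v).1 i * c v i + (zl v).2 * T ≤ -1 := fun v hv => by
    simp only [zl, dif_pos hv]
    exact Classical.choose_spec (hcert v hv)
  have hzl0 : ∀ v i, 0 ≤ (zl v).1 i := fun v i => by
    by_cases hv : f v = true
    · exact (hzl v hv).1 i
    · simp only [zl, dif_neg hv]
      exact le_rfl
  let M : ℝ := ∑ v : Fin n → Bool, ∑ k : Fin n, ∑ i, B i k * (zl v).1 i
  have hBz0 : ∀ v k, 0 ≤ ∑ i, B i k * (zl v).1 i := fun v k =>
    Finset.sum_nonneg fun i _ => mul_nonneg (hB i k) (hzl0 v i)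
  have hM : ∀ v k, ∑ i, B i k * (zl v).1 i ≤ M := fun v k =>
    calc ∑ i, B i k * (zl v).1 i ≤ ∑ k', ∑ i, B i k' * (zl v).1 i :=
          Finset.single_le_sum (f := fun k' => ∑ i, B i k' * (zl v).1 i) (fun k' _ => hBz0 v k')
            (Finset.mem_univ k)
      _ ≤ M := Finset.single_le_sum (f := fun v' => ∑ k', ∑ i, B i k' * (zl v').1 i)
            (fun v' _ => Finset.sum_nonneg fun k' _ => hBz0 v' k') (Finset.mem_univ v)
  have hM0 : 0 ≤ M := Finset.sum_nonneg fun v _ => Finset.sum_nonneg fun k _ => hBz0 v k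
  -- the dual gate: rows `Rw`, matrix index `Q'`
  let Rw := ((Fin q × Fin q) × Bool) ⊕ Fin n ⊕ Unit
  let Q' := Fin q ⊕ (Fin p ⊕ (Fin n ⊕ Unit))
  let blk : Fin q → Q' := fun u => Sum.inl u
  let zi : Fin p → Q' := fun i => Sum.inr (Sum.inl i)
  let mu : Fin n → Q' := fun k => Sum.inr (Sum.inr (Sum.inl k))
  let la : Q' := Sum.inr (Sum.inr (Sum.inr ()))
  let sgn : Bool → ℝ := fun s => if s then 1 else -1
  let A' : Rw → Matrix Q' Q' ℝ := fun row => match row with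
    | Sum.inl ((u, u'), s) => sgn s • (Matrix.single (blk u') (blk u) (1 : ℝ) -
        ∑ i, ((A i u u' + A i u' u) / 2) • Matrix.single (zi i) (zi i) (1 : ℝ) -
        (if u = u' then (1 : ℝ) else 0) • Matrix.single la la (1 : ℝ))
    | Sum.inr (Sum.inl k) => ∑ i, B i k • Matrix.single (zi i) (zi i) (1 : ℝ) -
        Matrix.single (mu k) (mu k) (1 : ℝ)
    | Sum.inr (Sum.inr _) => ∑ i, b i • Matrix.single (zi i) (zi i) (1 : ℝ) +
        ∑ k, Matrix.single (mu k) (mu k) (1 : ℝ) + T • Matrix.single la la (1 : ℝ)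
  let b' : Rw → ℝ := fun row => match row with
    | Sum.inl _ => 0
    | Sum.inr (Sum.inl _) => 0
    | Sum.inr (Sum.inr _) => -1
  let B' : Rw → Fin n → ℝ := fun row k' => match row with
    | Sum.inl _ => 0
    | Sum.inr (Sum.inl k) => if k' = k then M else 0
    | Sum.inr (Sum.inr _) => 0
  have hB' : ∀ row k', 0 ≤ B' row k' := by
    rintro (_ | k | _) k' <;> simp only [B'] <;> try exact le_rfl
    split_ifs
    · exact hM0
    · exact le_rfl
  have hwidth : Fintype.card Rw + Fintype.card Q' = 2 * (q * q) + q + p + 2 * n + 2 := by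
    simp only [Rw, Q', Fintype.card_sum, Fintype.card_prod, Fintype.card_fin, Fintype.card_bool,
      Fintype.card_unit]
    ring
  rw [← hwidth]
  refine isConvGate_of_sdp A' b' B' hB' f fun v => ?_
  -- the rows, evaluated at a matrix `Y'`
  have hind : ∀ k, (∑ k', (if k' = k then M else 0) * (if v k' then (1 : ℝ) else 0)) =
      M * (if v k then 1 else 0) := fun k => by
    rw [Finset.sum_eq_single k (fun k' _ hne => by rw [if_neg hne, zero_mul])
      (fun h => absurd (Finset.mem_univ k) h), if_pos rfl]
  have hrow1 : ∀ (Y' : Matrix Q' Q' ℝ) (u u' : Fin q) (s : Bool),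
      ((A' (Sum.inl ((u, u'), s)) * Y').trace ≤ b' (Sum.inl ((u, u'), s)) +
          ∑ k', B' (Sum.inl ((u, u'), s)) k' * (if v k' then (1 : ℝ) else 0)) ↔
        sgn s * (Y' (blk u) (blk u') - ∑ i, (A i u u' + A i u' u) / 2 * Y' (zi i) (zi i) -
          (if u = u' then (1 : ℝ) else 0) * Y' la la) ≤ 0 := fun Y' u u' s => by
    simp only [A', b', B', Matrix.smul_mul, Matrix.sub_mul, Matrix.sum_mul, trace_smul, trace_sub,
      trace_sum, Matrix.trace_single_mul, smul_eq_mul, one_mul, zero_mul, Finset.sum_const_zero, add_zero]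
  have hrow2 : ∀ (Y' : Matrix Q' Q' ℝ) (k : Fin n),
      ((A' (Sum.inr (Sum.inl k)) * Y').trace ≤ b' (Sum.inr (Sum.inl k)) +
          ∑ k', B' (Sum.inr (Sum.inl k)) k' * (if v k' then (1 : ℝ) else 0)) ↔
        ∑ i, B i k * Y' (zi i) (zi i) - Y' (mu k) (mu k) ≤ M * (if v k then 1 else 0) := fun Y' k => by
    simp only [A', b', B', Matrix.sub_mul, Matrix.sum_mul, Matrix.smul_mul, trace_sub, trace_sum,
      trace_smul, Matrix.trace_single_mul, smul_eq_mul, one_mul, zero_add, hind]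
  have hrow3 : ∀ (Y' : Matrix Q' Q' ℝ) (x : Unit),
      ((A' (Sum.inr (Sum.inr x)) * Y').trace ≤ b' (Sum.inr (Sum.inr x)) +
          ∑ k', B' (Sum.inr (Sum.inr x)) k' * (if v k' then (1 : ℝ) else 0)) ↔
        ∑ i, b i * Y' (zi i) (zi i) + ∑ k, Y' (mu k) (mu k) + T * Y' la la ≤ -1 := fun Y' x => by
    simp only [A', b', B', Matrix.add_mul, Matrix.sum_mul, Matrix.smul_mul, trace_add, trace_sum,
      trace_smul, Matrix.trace_single_mul, smul_eq_mul, one_mul, zero_mul,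
      Finset.sum_const_zero, add_zero]
  -- `zᵀ c(v) = zᵀ b + Σ_k [¬v_k] (Bᵀ z)_k`
  have hzc_expand : ∀ z : Fin p → ℝ, ∑ i, z i * c v i =
      ∑ i, b i * z i + ∑ k, (if v k then (0 : ℝ) else 1) * ∑ i, B i k * z i := fun z => by
    simp only [c, mul_add, Finset.sum_add_distrib, Finset.mul_sum]
    congr 1
    · exact Finset.sum_congr rfl fun i _ => mul_comm _ _
    · rw [Finset.sum_comm]
      exact Finset.sum_congr rfl fun k _ => Finset.sum_congr rfl fun i _ => by ring
  constructor
  · -- completeness: an accepted input ⇒ the chosen certificate, its matrix `P` and the slacks are feasible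
    intro hv
    obtain ⟨hz0, hl0, hP, hle⟩ := hzl v hv
    set z : Fin p → ℝ := (zl v).1 with hz
    set lam : ℝ := (zl v).2 with hlam
    set P : Matrix (Fin q) (Fin q) ℝ :=
      (2 : ℝ)⁻¹ • ∑ i, z i • (A i + (A i)ᵀ) + lam • (1 : Matrix (Fin q) (Fin q) ℝ) with hPdef
    let μ : Fin n → ℝ := fun k => (if v k then (0 : ℝ) else 1) * ∑ i, B i k * z i
    let d : Fin p ⊕ (Fin n ⊕ Unit) → ℝ := fun a => match a with
      | Sum.inl i => z i
      | Sum.inr (Sum.inl k) => μ k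
      | Sum.inr (Sum.inr _) => lam
    have hd : ∀ a, 0 ≤ d a := by
      rintro (i | k | _)
      · exact hz0 i
      · exact mul_nonneg (by split_ifs <;> norm_num) (hBz0 v k)
      · exact hl0
    refine ⟨Matrix.fromBlocks P 0 0 (Matrix.diagonal d), posSemidef_fromBlocks_diagonal hP hd, ?_⟩
    have hblk : ∀ u u', (Matrix.fromBlocks P 0 0 (Matrix.diagonal d)) (blk u) (blk u') = P u u' :=
      fun u u' => by simp [blk]
    have hzi : ∀ i, (Matrix.fromBlocks P 0 0 (Matrix.diagonal d)) (zi i) (zi i) = z i :=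
      fun i => by simp [zi, d]
    have hmu : ∀ k, (Matrix.fromBlocks P 0 0 (Matrix.diagonal d)) (mu k) (mu k) = μ k :=
      fun k => by simp [mu, d]
    have hla : (Matrix.fromBlocks P 0 0 (Matrix.diagonal d)) la la = lam := by simp [la, d]
    rintro (⟨⟨u, u'⟩, s⟩ | k | x)
    · rw [hrow1, hblk, hla]
      simp only [hzi]
      have hPu : P u u' = ∑ i, (A i u u' + A i u' u) / 2 * z i + (if u = u' then (1 : ℝ) else 0) * lam := by
        rw [hPdef, certMat_apply, Finset.mul_sum]
        congr 1
        · exact Finset.sum_congr rfl fun i _ => by ring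
        · ring
      rw [hPu]
      have : ∑ i, (A i u u' + A i u' u) / 2 * z i + (if u = u' then (1 : ℝ) else 0) * lam -
          ∑ i, (A i u u' + A i u' u) / 2 * z i - (if u = u' then (1 : ℝ) else 0) * lam = 0 := by ring
      rw [this, mul_zero]
    · rw [hrow2, hmu]
      simp only [hzi, μ]
      cases hvk : v k
      · simp
      · simp only [if_true, zero_mul, sub_zero, mul_one]
        exact hM v k
    · rw [hrow3 _ x, hla]
      simp only [hzi, hmu]
      have hμ : ∑ k, μ k = ∑ k, (if v k then (0 : ℝ) else 1) * ∑ i, B i k * z i := rfl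
      rw [hμ, ← hzc_expand z, show T * lam = lam * T from mul_comm _ _]
      exact hle
  · -- soundness: a feasible matrix gives a certificate `(z, λ, P)` at the complementary input
    rintro ⟨Y', hY', hc'⟩
    rw [hkey v]
    set z : Fin p → ℝ := fun i => Y' (zi i) (zi i) with hz
    set lam : ℝ := Y' la la with hlam
    set μ : Fin n → ℝ := fun k => Y' (mu k) (mu k) with hμ
    have hz0 : ∀ i, 0 ≤ z i := fun i => hY'.diag_nonneg
    have hl0 : 0 ≤ lam := hY'.diag_nonneg
    have hμ0 : ∀ k, 0 ≤ μ k := fun k => hY'.diag_nonneg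
    -- the block `P` of `Y'` is the certificate matrix
    have hPent : ∀ u u', Y' (blk u) (blk u') =
        ∑ i, (A i u u' + A i u' u) / 2 * z i + (if u = u' then (1 : ℝ) else 0) * lam := fun u u' => by
      have h1 := (hrow1 Y' u u' true).1 (hc' (Sum.inl ((u, u'), true)))
      have h2 := (hrow1 Y' u u' false).1 (hc' (Sum.inl ((u, u'), false)))
      simp only [sgn, if_true, one_mul, Bool.false_eq_true, if_false, neg_mul, neg_nonpos] at h1 h2
      simp only [hz, hlam]
      linarith
    have hPeq : Y'.submatrix blk blk =
        (2 : ℝ)⁻¹ • ∑ i, z i • (A i + (A i)ᵀ) + lam • (1 : Matrix (Fin q) (Fin q) ℝ) := by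
      ext u u'
      rw [Matrix.submatrix_apply, hPent, certMat_apply, Finset.mul_sum]
      congr 1
      · exact Finset.sum_congr rfl fun i _ => by ring
      · ring
    have hP : ((2 : ℝ)⁻¹ • ∑ i, z i • (A i + (A i)ᵀ) + lam • (1 : Matrix (Fin q) (Fin q) ℝ)).PosSemidef := by
      rw [← hPeq]
      exact hY'.submatrix _
    refine sdp_infeasible_of_cert A (c v) T z lam hz0 hl0 hP ?_
    have h3 := (hrow3 Y' ()).1 (hc' (Sum.inr (Sum.inr ())))
    have hk : ∀ k, (if v k then (0 : ℝ) else 1) * ∑ i, B i k * z i ≤ μ k := fun k => by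
      have h2 := (hrow2 Y' k).1 (hc' (Sum.inr (Sum.inl k)))
      cases hvk : v k
      · rw [hvk] at h2
        simp only [Bool.false_eq_true, if_false, one_mul, mul_zero] at h2 ⊢
        simp only [hz, hμ]
        linarith
      · simp only [if_true, zero_mul]
        exact hμ0 k
    rw [hzc_expand]
    have hsum := Finset.sum_le_sum fun k (_ : k ∈ Finset.univ) => hk k
    have h3' : ∑ i, b i * z i + ∑ k, μ k + T * lam ≤ -1 := h3
    nlinarith [h3', hsum, mul_comm T lam]

/-- **The CONV class is closed under Boolean duality** (the crux's gate vocabulary): if `g` is a CONV gate of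
width `s` and arity `n`, then its Boolean dual `x ↦ ¬ g(¬ x)` is a CONV gate of width `2s² + 3s + 2n + 2`.
[folklore] -/
theorem isConvGate_bdual {s n : ℕ} {g : (Fin n → Bool) → Bool} (hg : IsConvGate s ⟨n, g⟩) :
    IsConvGate (2 * (s * s) + 3 * s + 2 * n + 2) ⟨n, fun x => !g (fun i => !x i)⟩ := by
  obtain ⟨p, q, hpq, A, b, B, hB, hgv⟩ := hg
  have h := dualSDP_isConvGate n p q A b B hB (fun x => !g (fun i => !x i)) fun v => by
    show (!g fun i => !v i) = true ↔ _
    rw [Bool.not_eq_true', Bool.eq_false_iff, ne_eq, hgv]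
    have hind : ∀ (i : Fin p), (∑ j, B i j * (if (!v j) = true then (1 : ℝ) else 0)) =
        ∑ k, B i k * (if v k then (0 : ℝ) else 1) := fun i =>
      Finset.sum_congr rfl fun k _ => by cases v k <;> simp
    simp only [hind]
  refine h.mono ?_
  have hq : q ≤ s := by omega
  have hp : p ≤ s := by omega
  have h1 : q * q ≤ s * s := Nat.mul_le_mul hq hq
  omega

end

end Summit.PneNP.PneNP.Theorems.Capture.DualityAudit
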